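import Mathlib
import HarnessLib
import HarnessLib.Audit
import Summits.RiemannHypothesis.Statement
import HarnessLib.Audit.Status.Attr

/-!
Route: OddSector

# Route OddSector — one sign suffices — RH from a one-signed ODD ground state of Weil's windowed
form on unboundedly many windows (2001 A28 osd resurrected)

X = W-POS-odd ("it suffices to show"): on an UNBOUNDED set of windows a, Weil's quadratic form Q(g)
= W(g ⋆ g̃) restricted to ODD
test functions supported in [−a, a] has a bottom state u (u ∈ L², the L²-limit of an L²-normalised
minimising sequence of smooth odd
window tests — the operator-free encoding of Literature's IsWeilGroundState, with the oddness
clause) that is REAL and ≥ 0 a.e. on the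
right half-window (0, a). Why X suffices: the ODD THETA VECTOR H_a = −Φ′·𝟙_[−a,a] is odd, > 0 on
(0,a) and an almost-null vector of
the windowed operator ((Φ′)^(s) = −(s−½)ξ(s) vanishes at every nontrivial zero on or off the line),
and the pointwise supersolution
inequality A_aH_a ≥ −e(a)H_a on (0,a), e(a) → 0, turns one-signedness of u into the floor ε_od(a) ≥
−e(a) by Barta's inequality
(crux OddBartaFloor); ε_od is non-increasing in a, so ε_od ≥ 0 at every window, and odd-sector Weil
positivity at every window is RH
by Yoshida's odd criterion (crux OddNegativityOffLine — Yoshida's theorem in contrapositive,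
window-uniform form; in print, not yet in the tree). The route re-types the 2001 programme's Tier-A
entry
A28 (archive route odd-sector-eigenfunction-sign, rh2-box primary, CARDS Card A) — the only one of
its five Tier-A entries with no
route on this hub — into today's Statement; no separate Target decl is filed (X is literally the
rank-2 crux).
Lean: `∀ A : ℝ, ∃ a : ℝ, A ≤ a ∧ ∃ u : ℝ → ℂ, (MeasureTheory.MemLp u 2 ∧ ∃ g : ℕ → ℝ → ℂ, (∀ n,
Literature.NumberTheory.LFunctions.IsWeilTest (g n) ∧ tsupport (g n) ⊆ Set.Icc (-a) a ∧ (∀ t, g n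
(-t) = -g n t) ∧ ∫ t, ‖g n t‖ ^ 2 = (1 : ℝ)) ∧ (∀ h : ℝ → ℂ,
Literature.NumberTheory.LFunctions.IsWeilTest h → tsupport h ⊆ Set.Icc (-a) a → (∀ t, h (-t) = -h t)
→ ∫ t, ‖h t‖ ^ 2 = (1 : ℝ) → ∀ δ : ℝ, 0 < δ → ∀ᶠ n in Filter.atTop,
(Literature.NumberTheory.LFunctions.weilQuadratic (g n)).re ≤
(Literature.NumberTheory.LFunctions.weilQuadratic h).re + δ) ∧ Filter.Tendsto (fun n => ∫ t, ‖g n t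
- u t‖ ^ 2) Filter.atTop (nhds 0)) ∧ (∀ᵐ t : ℝ, t ∈ Set.Ioo 0 a → (u t).im = 0 ∧ 0 ≤ (u t).re)`

## Assembly
Pure logic over the three deciding items (Sketch.lean assembly_proof and glue.lean `closes`,
kernel-checked, axioms standard): assume
¬RH; OddNegativityOffLine gives η > 0 and A with a normalised odd test of energy ≤ −η at every
window a ≥ A; OddBartaFloor gives
e → 0 and a₀, hence A₁ beyond which e(a) < η; OddOneSignedWindows gives a ≥ max(A, a₀, A₁) with a
one-signed odd bottom state, so
−e(a) ≤ Re Q(h) ≤ −η < −e(a): contradiction. OddArchAnchor is support off the deciding path.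

Rationale: WHY THIS LINE. Spectral theory of positivity-improving semigroups brought to bear on Weil
positivity, in the ODD sector, through an explicit positive
almost-null vector. Since (Φ′)^(s) = −(s−½)ξ(s), the explicit formula gives W(g ⋆ (Φ′)~) = 0 for
every test g: Φ′ is a GLOBAL NULL
VECTOR of Weil's form, odd and one-signed (Φ = deBruijnPhi is even and decreasing); truncated to the
window, H_a = −Φ′𝟙 satisfies
A_aH_a = 𝒫^od + S − D + 𝒜^od with 𝒫^od, S, 𝒜^od ≥ 0 and 0 ≤ D ≤ e(a)|Φ′| on (0,a), e(a) ≲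
(1+1/2π)(log x)/√x + x^(9/2)e^(−πx),
x = e^(2a) (archive:2001/summits/rh/routes/odd-sector-eigenfunction-sign, results §§2–4, internally
refereed with two blind
re-derivations and a sign check to 1e−22), and Barta's inequality E⟨ψ,H_a⟩ = ⟨ψ, A_aH_a⟩ ≥
−e(a)⟨ψ,H_a⟩ converts the SIGN of one
odd eigenfunction ψ into ε_od(a) ≥ −e(a): no convergence of ground states to ξ, no Hurwitz, no
simplicity or evenness (contrast
WeilGroundState, SpectralTrace, ShiftedResolvent) and no comparison of sectors (contrast
WeilParity). The odd sector is where this is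
clean: Yoshida1992HermitianForms Prop. 1(1) (oddly positive definite ⇔ RH) carries no real-zero
caveat; restricted to odd functions
the pole form is the ATTRACTIVE rank-one term −2|⟨g, sinh(t/2)⟩|²; and the archimedean kernel folded
to (0,a), k(t−s) − k(t+s) with
k = weilArchDensity decreasing, is ≥ 0, so the prime atoms at ±log n are the only piece that is not
positivity-improving (2001 §7).
Imported tools: Krein–Rutman/Jentzsch and antisymmetric maximum principles for nonlocal operators
(doi:10.1016/j.jfa.2004.02.005
Bañuelos–Kulczycki Thm 4.3: the lowest antisymmetric eigenfunction of the Cauchy process on an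
interval is one-signed on the
half-interval; arXiv:1406.6181 Jarohs–Weth; arXiv:2203.11468 antisymmetric Hopf lemma),
Aronszajn–Krein rank-one theory for the
pole term, the resolvent/Perron–Frobenius criterion ((ε_od − E)(A_od − E)⁻¹H_a → P H_a) of the 2001
θ-road, and Connes' prolate
picture (Connes2026Letter §6; odd prolate functions have exactly one zero, DLMF 30.4) for the bulk
shape. Sources: Yoshida1992HermitianForms,
Bombieri2000Weil (§4 Problem 2, Lemma 1, Thm 3; §5), ConnesSuijlekom2025, Connes2026Letter,
Suzuki2026 (arXiv:2606.09096),
ConnesConsani2023 (arXiv:2106.01715 §2.2 σ± blocks), arXiv:2511.22755 §§3, 8. What prior routes and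
the negatives index do not do:
none of the ten open Weil-family routes uses the odd theta vector, Barta's inequality or the sign of
an odd eigenfunction; in print the
odd sector of A_a "has not been probed" (arXiv:2605.20224 §10, as WeilGroundState's novelty section
records); the one negatives entry
(LaplaceLoophole) is in another family.

RANKED CRUXES. #2 OddOneSignedWindows (crux) — W-POS-odd, ∃-form (2001 wall rh-w-pos-odd as retyped
after §10): for every A there is a window a ≥ A and an odd bottom state u of Weil's form at a (u ∈
L², L²-limit of an L²-normalised minimising sequence of smooth odd tests supported in [−a,a],
minimising = eventually below every normalised odd window test up to any δ > 0) with Im u = 0 and Re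
u ≥ 0 a.e. on (0,a). [difficulty: open-problem] (why it might fail: One-signedness FAILS at a = log
q and at logs of reachable rationals (2001 §10: origin cusp ψ ≈ −Λ(q)q^{−1/2}c₊ℓ(t)^{3/2}; two-sided
holes of width ~e^{−πx}); F_q analogue census: one-signed window fraction .55/.24/.15/.10 at genus
2–5 — the set of good windows may be bounded for ζ even under RH.) [Yoshida1992HermitianForms,
Bombieri2000Weil, arXiv:2606.09096, Connes2026Letter,
archive:2001/summits/rh/routes/odd-sector-eigenfunction-sign]
#3 OddBartaFloor (crux) — THE ODD BARTA FLOOR (2001 internal Thm 4.1(iii)/Cor 4.2, unpublished,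
hence a crux): there are e : ℝ → ℝ with e(a) → 0 and a₀ such that at every window a ≥ a₀ that
carries a one-signed odd bottom state, every L²-normalised smooth odd test supported in [−a,a] has
Re Q ≥ −e(a) (i.e. ε_od(a) ≥ −e(a)). Mechanism: the odd theta vector H_a = −Φ′𝟙_[−a,a] is a
pointwise supersolution, A_aH_a ≥ −e(a)H_a on (0,a), and Barta's identity E⟨ψ,H_a⟩ = ⟨ψ,A_aH_a⟩ for
the one-signed minimiser ψ. Consequence of RH (take e ≡ 0: Sketch.lean oddBartaFloor_of_rh) but
RH-free in substance. [difficulty: L] (why it might fail: Internal-refereed only (2001 Thm 3.2/4.1):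
a sign/normalisation slip in the wrong-sign prime layer D_a (its ratio to |Φ′| near t → a gives e₁ ~
(log x)/√x) would leave e(a) ↛ 0; and the step from smooth tests to the L²-limit u needs Bombieri's
Lemma-1 Euler–Lagrange identity in the odd sector.) [Bombieri2000Weil, arXiv:2511.22755,
archive:2001/summits/rh/routes/odd-sector-eigenfunction-sign]
#4 OddNegativityOffLine (crux) — Yoshida 1992 Prop. 1(1), hard half, in contrapositive, normalised
and made window-uniform by monotonicity (in print; not yet in the tree, whose parity-free converse
is riemannHypothesis_of_zeroSide_nonneg by two-node translateMix families): if RH fails there are η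
> 0 and A such that every window a ≥ A carries an L²-normalised smooth odd test h supported in
[−a,a] with Re Q(h) ≤ −η (one odd test h₀ = α₁+α₂−α̌₁−α̌₂ with Q(h₀) < 0 from an off-line zero,
Yoshida's proof / Bombieri 2000 §5, rescaled, serves every larger window). [difficulty: M] (why it
might fail: In print (Yoshida 1992 Prop. 1(1); Bombieri 2000 §5) but unformalised: the odd witness
needs the explicit formula for translated/reflected pairs with cross-term control as the translation
grows; the real risk is a mismatch between Yoshida's test class and IsWeilTest at the normalisation
step.) [Yoshida1992HermitianForms, Bombieri2000Weil,
Literature.NumberTheory.LFunctions.riemannHypothesis_of_zeroSide_nonneg]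
#9 OddArchAnchor (support) — THE PRIME-FREE ANCHOR (2001 wall W-ARCH-odd, proved twice internally
for every a > 0; off the deciding path — it is the first lemma of the homotopy Approach and the
in-kind inhabitant of the thesis): for the archimedean part Q₀(g) = Re W_∞(g ⋆ g̃) alone, every
window a > 0 carries an odd bottom state (minimising among smooth odd window tests for Q₀) that is
real and ≥ 0 a.e. on (0,a) (2001 COR 1.3 adds ε_od < λ_2,ev, edge value c₊(φ₀) > 0 by a
Rellich–Pohozaev identity, φ₀ ∈ C^∞ with φ₀′(0) > 0; cf. the 1-D logarithmic Laplacian,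
arXiv:2311.13079 §8). [difficulty: L] [archive:2001/summits/rh/routes/odd-sector-eigenfunction-sign,
arXiv:2311.13079, doi:10.1016/j.jfa.2004.02.005]

TWO-LAYER PLAN. Once OddBartaFloor lands (it is the 2001 step-2 theorem re-proved against the tree's
WeilExplicit), split the thesis crux along the
2001 programme's FINAL road (θ-anchor chain row 646bf9e9, results §§15–16), k = 3, exactly as typed
and lean-checked in the birth
skeleton bc/OddOneSignedWindows_birth.lean: OddOneSignedWindows ⇐ ThetaOverlap [(θ1): on an
unbounded window set every odd bottom
state overlaps the source, ⟨u, H_a⟩ ≠ 0] → ResolventPositiveNearBottom [(W-θ-MID″ ∧ (θ2)_swap — the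
RH-strength conjunct): the
theta-sourced resolvent vectors v_E = (A_a,od − E)⁻¹H_a, encoded as minimisers of Re Q − E‖·‖² −
2Re⟨·,H_a⟩, are ≥ 0 on (0,a)
for E in a left neighbourhood of ε_od(a); the far range E ≤ −E₆(a) is the proved θ-anchor] →
ResolventCriterion [RH-free spectral
theory: (ε_od − E)v_E → P H_a ≠ 0, and the limit is a one-signed bottom state] →
OddOneSignedWindows. The alternative λ-road
(prime-weight homotopy Q_λ = Q₀ + λ(Q − Q₀) from OddArchAnchor; openness at λ = 0 on the
full-measure Diophantine window class,
2001 Thm 11.13; three Hopf lemmas suffice, Thm 11.18) is Approach 2, with its recorded diagnosis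
(first failure λ* → 0 by edge-trace
transport) — not filed. Nothing here is filed now.

KILL CRITERIA. (k1) OddBartaFloor refuted — a window carrying a one-signed odd bottom state with
ε_od(a) below every admissible −e(a), or a sign error
in 2001 Thm 3.2/4.1 that no renormalisation repairs — closes the route `refuted:OddBartaFloor` (the
theta-vector mechanism is then dead
for both sectors; file the barrier note). (k2) A certified odd-block computation (trig-Galerkin σ⁻
blocks of ConnesConsani2023 §2.2,
interval arithmetic, Diophantine windows with 5 ≤ x = e^(2a) ≤ 27, where the 2001 tables certify
parity separation and an even simple
ground state) showing that the odd bottom changes sign IN THE BULK (not only in an e^(−πx)-thin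
origin/edge layer) at every sampled
window makes the strict thesis implausible: restate OddOneSignedWindows to the robust bulk form of
2001 Thm 5.2 (ψ ≥ 0 on (0, a−η]
plus a layer-mass bound, with the matching robust floor) by `--restate`, or close `exhausted` if the
bulk sign fails too. (k3) The
function-field transfer census (2001 Card A: fraction of one-signed windows for curves over F_q,
.55/.24/.15/.10 at g = 2–5) extended
to g ≤ 8 showing NO one-signed window for some curve (whose RH holds) ⇒ the mechanism does not
consume RH-type structure: close
`exhausted` with the census attached. (k4) GroundStateSimpleEven + GroundStatesConvergeToXi
(WeilGroundState) proved ⇒ RH closes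
there and this route is moot. NOT a kill: failure of one-signedness at a = log q or on any bounded /
measure-zero window set (the thesis
is ∃-unbounded by design, 2001 Cor 10.4 / Thm 10.8).

NOT DECOMPOSED YET. The supersolution decomposition A_aH_a = 𝒫^od + S − D + 𝒜^od and its constants;
the regularity of odd bottom states (boundedness,
continuity, edge traces c±, the Euler–Lagrange identity of Bombieri's Lemma 1 in the odd sector);
existence of minimisers (Bombieri
2000 Thm 3 is not in the tree — the thesis asserts a one-signed one on its own windows, and
OddBartaFloor is vacuous where none
exists); the choice of the unbounded window set (2001's full-measure Diophantine class avoiding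
every log m); and the θ-road walls of
the two-layer plan. All are layer-2 children or `--supports` lemmas. No operator A_a, no λ-family,
no prolate functions and no theta
vector are posited as Lean objects: every item is variational and operator-free (as Literature's
IsWeilGroundState), so no definition
blocks the items; the definition requests below are conveniences.

CHEAPEST FALSIFIER. For the mechanism (OddBartaFloor): re-derive at ONE window (x = 5: prime atoms
at log 2, log 3, log 4 only; closed form of A_aH_a in
the 2001 λ-hopf notes §14.9) the sign pattern 𝒫^od, S, 𝒜^od ≥ 0 and the bound D ≤ e|Φ′| on (0,a) —
one page plus a 50-digit
quadrature (the 2001 blind checks C1–C4 confirmed it to 1e−22; not re-run in this session). For the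
thesis: one float Galerkin
diagonalisation of the odd block at x = 5 (2001 floats: ψ₁ > 0 on (0,a), ⟨ψ₁, Ĥ_a⟩ = 0.9945) and at
three Diophantine windows with
x ∈ [9, 27] resolving the origin layer; bulk sign changes at all three send the route to (k2) within
a day. Lookups done: Yoshida 1992
Prop. 1(1) and arXiv:2606.09096 p. 2 confirm 'oddly p.d. ⇒ RH' with no real-zero caveat;
arXiv:2605.20224 §10 and the searches in
§ Novelty found no printed statement on the sign of odd eigenfunctions of A_a.

NUMBERS. Unconditional odd theta level ε_od(a) ≤ 2δ^od_a ≤ 312·C_T(x)·x^(13/4)e^(−πx), C_T ~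
1.18x^(1/4), x = e^(2a) ≥ 2 (2001 Thm 3.2);
e(a) ≤ e₁(x) + e₂(a), e₁ ~ (1+1/2π)(log x)/√x, e₂ ≤ Cx^(9/2)e^(−πx) (Thm 4.1(ii)); certified parity
separation ε_ev < ε_od < λ₂^ev
on 2 ≤ x ≤ 4.5 (Lem 10.3) and even simple ground state on x ∈ [2, 26.6] (2001 RESULTS-window);
one-signedness fails at a = log q,
q = 2, 3, 4 (Thm 10.8), first failure a* ∈ [½log 2, log 2) by touchdown (Cor 10.4, Thm T); floats at
x = 5: odd bottom ψ₁ > 0 on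
(0,a) (2001-08-09 06:43); Suzuki2026 Thm 1.4: simple even positive ground state for a ≤ a₀ ≈ 1/100;
refuter data on this hub
(WeilParity/WeilGroundState): ε(0.347) = 1.49e−3, ε(0.5) = 1.28e−6, odd/even bottom ratio 57 → 640
on a ∈ [0.35, 0.7], odd ground
state Poincaré ratio √(‖o′‖²/‖o‖²) = 4.69 at (log 2)/2, 3.59 at 0.7
(Cruxes/GroundStateSimpleEven/Disproof §5).

DEFINITION REQUESTS. IsWeilOddGroundState a u and weilOddGroundEnergy a
(Literature/NumberTheory/LFunctions, mirroring IsWeilGroundState / weilGroundEnergy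
with the oddness clause ∀ t, g(−t) = −g t) — the items inline them meanwhile; weilOddThetaVector a
(−Φ′·𝟙_[−a,a] in the tree's
deBruijnPhi normalisation, with the identity (Φ′)^(s) = −(s−½)ξ(s)) for the OddBartaFloor line. Cite
fact wanted: Yoshida 1992
Prop. 1(1) (odd criterion) as a Literature fact next to
riemannHypothesis_iff_forall_weilPositivityOn. CONE NOTE (route-repair unit
rrepair-RiemannHypothesis-OddSector-fb39d924, rev 1, 2026-08-17): needs-fact: NONE. Since rev 1
every item is stated over MATHLIB PRIMITIVES ONLY and the route file imports nothing from
Literature/ — IsWeilTest g ↦ ContDiff ℝ ((⊤ : ℕ∞) : WithTop ℕ∞) g ∧ HasCompactSupport g; weilConv g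
(weilReflect g) ↦ C g with the binder C := fun g => MeasureTheory.convolution g (fun t =>
(starRingEnd ℂ) (g (-t))) (ContinuousLinearMap.mul ℂ ℂ) volume; weilMellin F s ↦ M F s with M := fun
F s => ∫ t, F t * Complex.exp ((s - 1/2) * t); weilQuadratic g ↦ Q g with Q := fun g => M (C g) 0 +
M (C g) 1 − Σ' Λ(n) n^{−1/2} (C g (log n) + C g (−log n)) + ((1/2π) ∫ M (C g) (1/2 + it) · Re ψ(1/4
+ it/2) dt − C g 0 · log π) (polar − prime + archimedean, the tree's weilFunctional order);
weilArchTerm (weilConv g (weilReflect g)) ↦ Q₀ g (the archimedean summand alone, OddArchAnchor) —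
and each rev-1 statement is DEFINITIONALLY EQUAL to its rev-0 form over
Literature.NumberTheory.LFunctions.WeilExplicit (certified `example : ConeFree.X ↔ X := Iff.rfl` for
all four items and the Assembly, lean check rc 0, folder Defeq.lean; negative control DefeqNeg.lean
with `≤ −η ↦ < −η` and a flipped prime-term sign fails exactly on the two perturbed items, as it
should), so provers import WeilExplicit in their Theorems file and `show`/`change` to the Literature
vocabulary at will (idiom checked in Defeq.lean) and use its API (explicit_formula_holds,
weil_criterion_holds, WeilPositivity.of_riemannHypothesis,
weilArchTermBombieri_eq_weilArchTerm_holds, riemannHypothesis_of_zeroSide_nonneg); the BC3 birth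
skeletons attached by the opener to the rev-0 items stmt-RiemannHypothesis-17360/17361/17362
(Lines/birth.lean, `<Decl>_of` concluding the decl BY NAME) stay valid verbatim since decl names and
definitional content are unchanged. WHY: the route file's only Literature import, WeilExplicit.lean,
co-hosts the @[conjecture] [status: open] decl Literature.NumberTheory.LFunctions.WeilPositivity (↔
RH in-tree by weil_criterion_holds; never dischargeable short of the summit, so it must not become
tier-0 debt), which the Phase-C guardrail counts as an unproved named fact of the MODULE cone and
therefore withholds provers (blocked-by-cone, 1 fact, XL) although no item and no line of `closes`
names it and the gate's used-constants cone has 0 unproved deps (17 constants, staffable YES). No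
narrower module provides the vocabulary, so the import could not be trimmed — only removed by
inlining. With no Literature import the module cone is Mathlib + HarnessLib +
Summits.RiemannHypothesis.Statement: conjecture-free (same ruling and same dictionary as route
SignCone rev 3, which has been staffed since; routes WeilParity / ShiftedResolvent kept the import
and show no prover seat 34 h later). CAVEAT (tenure): a `_holds` link whose Theorems module is
IMPORTED here would re-import WeilExplicit (Theorems files that import this Theses file are linked
by docstring, no import — the normal case); the durable fix is operator-side (exempt @[conjecture]
decls from the module-cone census, as the gate's deps cone already does, or move WeilPositivity with
its weil_criterion users into a leaf module) — requested before by the SpectralTrace g4, WeilParity,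
ShiftedResolvent and SignCone repair units; once it lands, `route edit --restate` each item back to
its rev-0 text (defeq, same decl names) restores the short statements.

Novelty: Searches (2026-08-17): `lit galaxy search "oddly positive definite" --star all` (1 noise hit), `lit
galaxy search "Hermitian forms attached to zeta functions" --star all` (3 hits: Montgomery–Vaughan,
two unrelated pdfs; none on the odd sector), `lit galaxy search "odd eigenfunction Weil quadratic
form" --star all` (0), `lit galaxy search "Barta's inequality" --star all` (1: Kähler Laplacian),
`lit search --source s2 "antisymmetric eigenfunction positivity nonlocal Schrodinger operator
interval"` (1: arXiv:2511.02978, superposition operators, unrelated); local index / OpenAlex / arXiv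
cascade unavailable in this session (searchd reset, HTTP 429 — recorded, no claim rests on them);
`lean search --decl 'oddly|OneSigned|Barta|oddBottom|OddGround'` (no landed theorem of shape C → S
or S ↔ C; Cruxes/GroundStateSimpleEven/Disproof.not_oddGroundState refutes only 'the GLOBAL bottom
is odd and simple', neither asserted nor needed here); `ledger negatives --problem
RiemannHypothesis` (1 entry, other family); `ledger idea list` (≈141 RH cards read by
title/mechanism: none on the odd theta vector or Barta); the 23 open route theses (WeilParity and
WeilGroundState read in full; Weil-family items grepped for odd/Yoshida/theta-vector/null-vector
content: none). summit-strength-explained: OddOneSignedWindows is RH-sufficient through two RH-free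
theorems (OddBartaFloor, internal; Yoshida's odd criterion, in print), hence at least summit
strength; the why-easier is that the transferred stateme  [refs: 10.1016/j.jfa.2004.02.005, 2511.02978, 2511.22755, 2606.09096, 2605.20224, doi:10.1016/j.jfa.2004.02.005, ConnesSuijlekom2025, Suzuki2026]

Barriers (technique_class: Weil-positivity, odd-sector Barta, ground-state sign): - technique_class: Weil-positivity, odd-sector Barta, ground-state sign
- Literature.Barriers.RiemannHypothesis.DeBrangesPositivity: not engaged — no positivity beyond
Weil's is asserted; the only unconditional positivity claimed is the floor −e(a) (RH-free, internal
theorem), and the thesis is a sign property of an eigenfunction, not a de Branges kernel condition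
(Conrey–Li's counterexamples concern (3.1)/(3.3) of de Branges spaces).
- Literature.Barriers.RiemannHypothesis.NewmanConjecture: consistent — Λ ≥ 0 forbids margins and
none is produced: ε_od(a) → 0⁺ super-exponentially (odd theta level ≤ x^(13/4)e^(−πx)) and the
thesis is a scale-free SIGN statement; the floor −e(a) has the wrong sign to be a margin. The bet is
that sign structure, unlike margins, survives 'barely true'.
- Literature.Barriers.RiemannHypothesis.DavenportHeilbronn: evaded in kind — Λ(n) ≥ 0 enters as
positive jump weights at ±log n (the supersolution inequality uses 𝒫^od ≥ 0 term by term) and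
Yoshida's criterion uses ζ's Euler product; for the Davenport–Heilbronn function the weights are
signed and both steps fail, so the argument cannot prove the false DH-RH.
- Literature.Barriers.RiemannHypothesis.RamanujanAxiomNecessity: not engaged — nothing is claimed
for a class of L-functions; every step uses ζ's own explicit formula (explicit_formula_holds) and
deBruijnPhi.
- Literature.Barriers.RiemannHypothesis.PseudoLaplacianSpacing: not met — no claim that ordinates
are eigenvalues of a self-adjoint opera

History (route lifecycle, newest last):
- 2026-08-17T02:10:15Z · rev 1: restated OddOneSignedWindows (stmt-RiemannHypothesis-17360), OddBartaFloor (stmt-RiemannHypothesis-17361), OddNegativityOffLine (stmt-RiemannHypothesis-17362), OddArchAnchor (stmt-RiemannHypothesis-17363) — route-repair (cone, rrepair-RiemannHypothesis-OddSector-fb39d924): rerouted — import Literature.NumberTheo (planner-rrepair-RiemannHypothesis-OddSector-fb39d924-0)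

sub-problem: RiemannHypothesis · status: open · opened planner-plan-lens3-RiemannHypothesis-resurrect-g3-0 2026-08-17T01:51:24Z · rev 1 · ledger route-RiemannHypothesis-OddSector
GENERATED by the gate from the ledger (D-0016/17). Provers cite these decls: `theorem foo : Summit.RiemannHypothesis.RiemannHypothesis.Theses.OddSector.<Decl> := …` in Summits/RiemannHypothesis/RiemannHypothesis/Theorems/<Name>.lean.
-/

namespace Summit.RiemannHypothesis.RiemannHypothesis.Theses.OddSector

open scoped BigOperators Topology Manifold Classical MeasureTheory ProbabilityTheory Matrix InnerProductSpace ComplexConjugate ContinuousMap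
open Filter Set Function TopologicalSpace MeasureTheory

attribute [summit_statement] _root_.Summit.RiemannHypothesis

open Summit

-- earlier OddOneSignedWindows (stmt-RiemannHypothesis-17360, replaced 2026-08-17T02:10:15Z -> stmt-RiemannHypothesis-17778): retired by None — ∀ A : ℝ, ∃ a : ℝ, A ≤ a ∧ ∃ u : ℝ → ℂ, (MeasureTheory.MemLp u 2 ∧ ∃ g : ℕ → ℝ → ℂ, (∀ n, Literature.NumberTheory.LFunctions.IsWeilTest (g n) ∧ tsupport (g n) ⊆ Set.Icc (-a) a ∧ (∀ t, g n (-t) = -g n t) ∧ ∫ t, ‖g n t‖ ^ 2 = (1 : ℝ)) ∧ (∀ h : ℝ → ℂ, Literature.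
/-- item stmt-RiemannHypothesis-17778 · crux · rank 2 · open · by planner
why it might fail: One-signedness FAILS at a = log q and at logs of reachable rationals (2001 §10: origin cusp ψ ≈ −Λ(q)q^{−1/2}c₊ℓ(t)^{3/2}; two-sided holes of width ~e^{−πx}); F_q analogue census: one-signed window fraction .55/.24/.15/.10 at genus 2–5 — the set of good windows may be bounded for ζ even under RH.
sources: Yoshida1992HermitianForms, Bombieri2000Weil, arXiv:2606.09096, Connes2026Letter, archive:2001/summits/rh/routes/odd-sector-eigenfunction-sign
[crux] W-POS-odd, ∃-form (2001 wall rh-w-pos-odd as retyped after §10): for every A there is a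
window a ≥ A and an odd bottom state u of Weil's form at a (u ∈ L², L²-limit of an L²-normalised
minimising sequence of smooth odd tests supported in [−a,a], minimising = eventually below every
normalised odd window test up to any δ > 0) with Im u = 0 and Re u ≥ 0 a.e. on (0,a). [difficulty:
open-problem] [Lean form, rev 1 (route-repair cone, 2026-08-17): stated over Mathlib primitives only
— binders C (autocorrelation g ⋆ g̃), M (Mellin–Laplace transform), Q (Weil's quadratic functional,
polar − prime + archimedean) — and DEFINITIONALLY EQUAL (Iff.rfl, Defeq.lean) to the rev-0 form over
Literature.NumberTheory.LFunctions.WeilExplicit (rev-0 item stmt-RiemannHypothesis-17360: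
IsWeilTest, weilQuadratic); provers `show` the Literature form at will.] -/
@[route_item "route-RiemannHypothesis-OddSector", crux]
def OddOneSignedWindows : Prop :=
  let C : (ℝ → ℂ) → ℝ → ℂ := fun g => MeasureTheory.convolution g (fun t => (starRingEnd ℂ) (g (-t))) (ContinuousLinearMap.mul ℂ ℂ) MeasureTheory.MeasureSpace.volume; let M : (ℝ → ℂ) → ℂ → ℂ := fun F s => ∫ t : ℝ, F t * Complex.exp ((s - 1 / 2) * t); let Q : (ℝ → ℂ) → ℂ := fun g => M (C g) 0 + M (C g) 1 - (∑' n : ℕ, ((ArithmeticFunction.vonMangoldt n : ℝ) : ℂ) / (Real.sqrt n : ℂ) * (C g (Real.log n) + C g (-Real.log n))) + ((1 / (2 * Real.pi) : ℂ) * (∫ t : ℝ, M (C g) (1 / 2 + t * Complex.I) * ((Complex.digamma (1 / 4 + t / 2 * Complex.I)).re : ℂ)) - C g 0 * (Real.log Real.pi : ℂ)); ∀ A : ℝ, ∃ a : ℝ, A ≤ a ∧ ∃ u : ℝ → ℂ, (MeasureTheory.MemLp u 2 ∧ ∃ g : ℕ → ℝ → ℂ, (∀ n, (ContDiff ℝ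 ((⊤ : ℕ∞) : WithTop ℕ∞) (g n) ∧ HasCompactSupport (g n)) ∧ tsupport (g n) ⊆ Set.Icc (-a) a ∧ (∀ t, g n (-t) = -g n t) ∧ ∫ t, ‖g n t‖ ^ 2 = (1 : ℝ)) ∧ (∀ h : ℝ → ℂ, (ContDiff ℝ ((⊤ : ℕ∞) : WithTop ℕ∞) h ∧ HasCompactSupport h) → tsupport h ⊆ Set.Icc (-a) a → (∀ t, h (-t) = -h t) → ∫ t, ‖h t‖ ^ 2 = (1 : ℝ) → ∀ δ : ℝ, 0 < δ → ∀ᶠ n in Filter.atTop, (Q (g n)).re ≤ (Q h).re + δ) ∧ Filter.Tendsto (fun n => ∫ t, ‖g n t - u t‖ ^ 2) Filter.atTop (nhds 0)) ∧ (∀ᵐ t : ℝ, t ∈ Set.Ioo 0 a → (u t).im = 0 ∧ 0 ≤ (u t).re)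

-- earlier OddBartaFloor (stmt-RiemannHypothesis-17361, replaced 2026-08-17T02:10:15Z -> stmt-RiemannHypothesis-17779): retired by None — ∃ e : ℝ → ℝ, Filter.Tendsto e Filter.atTop (nhds 0) ∧ ∃ a₀ : ℝ, ∀ a : ℝ, a₀ ≤ a → (∃ u : ℝ → ℂ, (MeasureTheory.MemLp u 2 ∧ ∃ g : ℕ → ℝ → ℂ, (∀ n, Literature.NumberTheory.LFunctions.IsWeilTest (g n) ∧ tsupport (g n) ⊆ Set.Icc (-a) a ∧ (∀ t, g n (-t) = -g n t) ∧ ∫ t,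
/-- item stmt-RiemannHypothesis-17779 · crux · rank 3 · closed · proved by Summit.RiemannHypothesis.RiemannHypothesis.Theorems.OddBartaFloor.OddBartaFloor_of @ ea8c89e7ebde (prover) · by planner
why it might fail: Internal-refereed only (2001 Thm 3.2/4.1): a sign/normalisation slip in the wrong-sign prime layer D_a (its ratio to |Φ′| near t → a gives e₁ ~ (log x)/√x) would leave e(a) ↛ 0; and the step from smooth tests to the L²-limit u needs Bombieri's Lemma-1 Euler–Lagrange identity in the odd sector.
sources: Bombieri2000Weil, arXiv:2511.22755, archive:2001/summits/rh/routes/odd-sector-eigenfunction-sign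
[crux] THE ODD BARTA FLOOR (2001 internal Thm 4.1(iii)/Cor 4.2, unpublished, hence a crux): there
are e : ℝ → ℝ with e(a) → 0 and a₀ such that at every window a ≥ a₀ that carries a one-signed odd
bottom state, every L²-normalised smooth odd test supported in [−a,a] has Re Q ≥ −e(a) (i.e. ε_od(a)
≥ −e(a)). Mechanism: the odd theta vector H_a = −Φ′𝟙_[−a,a] is a pointwise supersolution, A_aH_a ≥
−e(a)H_a on (0,a), and Barta's identity E⟨ψ,H_a⟩ = ⟨ψ,A_aH_a⟩ for the one-signed minimiser ψ.
Consequence of RH (take e ≡ 0: Sketch.lean oddBartaFloor_of_rh) but RH-free in substance.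
[difficulty: L] [Lean form, rev 1 (route-repair cone, 2026-08-17): stated over Mathlib primitives
only — binders C (autocorrelation g ⋆ g̃), M (Mellin–Laplace transform), Q (Weil's quadratic
functional, polar − prime + archimedean) — and DEFINITIONALLY EQUAL (Iff.rfl, Defeq.lean) to the
rev-0 form over Literature.NumberTheory.LFunctions.WeilExplicit (rev-0 item
stmt-RiemannHypothesis-17361: IsWeilTest, weilQuadratic); provers `show` the Literature form at
will.] -/
@[route_item "route-RiemannHypothesis-OddSector", crux]
def OddBartaFloor : Prop :=
  let C : (ℝ → ℂ) → ℝ → ℂ := fun g => MeasureTheory.convolution g (fun t => (starRingEnd ℂ) (g (-t))) (ContinuousLinearMap.mul ℂ ℂ) MeasureTheory.MeasureSpace.volume; let M : (ℝ → ℂ) → ℂ → ℂ := fun F s => ∫ t : ℝ, F t * Complex.exp ((s - 1 / 2) * t); let Q : (ℝ → ℂ) → ℂ := fun g => M (C g) 0 + M (C g) 1 - (∑' n : ℕ, ((ArithmeticFunction.vonMangoldt n : ℝ) : ℂ) / (Real.sqrt n : ℂ) * (C g (Real.log n) + C g (-Real.log n))) + ((1 / (2 * Real.pi) : ℂ) *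 (∫ t : ℝ, M (C g) (1 / 2 + t * Complex.I) * ((Complex.digamma (1 / 4 + t / 2 * Complex.I)).re : ℂ)) - C g 0 * (Real.log Real.pi : ℂ)); ∃ e : ℝ → ℝ, Filter.Tendsto e Filter.atTop (nhds 0) ∧ ∃ a₀ : ℝ, ∀ a : ℝ, a₀ ≤ a → (∃ u : ℝ → ℂ, (MeasureTheory.MemLp u 2 ∧ ∃ g : ℕ → ℝ → ℂ, (∀ n, (ContDiff ℝ ((⊤ : ℕ∞) : WithTop ℕ∞) (g n) ∧ HasCompactSupport (g n)) ∧ tsupport (g n) ⊆ Set.Icc (-a) a ∧ (∀ t, g n (-t) = -g n t) ∧ ∫ t, ‖g n t‖ ^ 2 = (1 : ℝ)) ∧ (∀ h : ℝ → ℂ, (ContDiff ℝ ((⊤ : ℕ∞) : WithTop ℕ∞) h ∧ HasCompactSupport h) → tsupport h ⊆ Set.Icc (-a) a → (∀ t, h (-t) = -h t) → ∫ t, ‖h t‖ ^ 2 = (1 : ℝ) → ∀ δ : ℝ, 0 < δ → ∀ᶠ n in Filter.atTop, (Q (g n)).re ≤ (Q h).re + δ) ∧ Filter.Tendsto (fun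 n => ∫ t, ‖g n t - u t‖ ^ 2) Filter.atTop (nhds 0)) ∧ (∀ᵐ t : ℝ, t ∈ Set.Ioo 0 a → (u t).im = 0 ∧ 0 ≤ (u t).re)) → ∀ h : ℝ → ℂ, (ContDiff ℝ ((⊤ : ℕ∞) : WithTop ℕ∞) h ∧ HasCompactSupport h) → tsupport h ⊆ Set.Icc (-a) a → (∀ t, h (-t) = -h t) → ∫ t, ‖h t‖ ^ 2 = (1 : ℝ) → -e a ≤ (Q h).re

-- earlier OddNegativityOffLine (stmt-RiemannHypothesis-17362, replaced 2026-08-17T02:10:15Z -> stmt-RiemannHypothesis-17780): retired by None — ¬ RiemannHypothesis → ∃ η : ℝ, 0 < η ∧ ∃ A : ℝ, ∀ a : ℝ, A ≤ a → ∃ h : ℝ → ℂ, Literature.NumberTheory.LFunctions.IsWeilTest h ∧ tsupport h ⊆ Set.Icc (-a) a ∧ (∀ t, h (-t) = -h t) ∧ ∫ t, ‖h t‖ ^ 2 = (1 : ℝ) ∧ (Literature.NumberTheory.LFunctions.weilQuadratic 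
/-- item stmt-RiemannHypothesis-17780 · crux · rank 4 · closed · proved by Summit.RiemannHypothesis.RiemannHypothesis.Theorems.oddNegativityOffLine_proof @ ab228cc75535 (prover) · by planner
why it might fail: In print (Yoshida 1992 Prop. 1(1); Bombieri 2000 §5) but unformalised: the odd witness needs the explicit formula for translated/reflected pairs with cross-term control as the translation grows; the real risk is a mismatch between Yoshida's test class and IsWeilTest at the normalisation step.
sources: Yoshida1992HermitianForms, Bombieri2000Weil, Literature.NumberTheory.LFunctions.riemannHypothesis_of_zeroSide_nonneg
[crux] Yoshida 1992 Prop. 1(1), hard half, in contrapositive, normalised and made window-uniform by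
monotonicity (in print; not yet in the tree, whose parity-free converse is
riemannHypothesis_of_zeroSide_nonneg by two-node translateMix families): if RH fails there are η > 0
and A such that every window a ≥ A carries an L²-normalised smooth odd test h supported in [−a,a]
with Re Q(h) ≤ −η (one odd test h₀ = α₁+α₂−α̌₁−α̌₂ with Q(h₀) < 0 from an off-line zero, Yoshida's
proof / Bombieri 2000 §5, rescaled, serves every larger window). [difficulty: M] [Lean form, rev 1
(route-repair cone, 2026-08-17): stated over Mathlib primitives only — binders C (autocorrelation g
⋆ g̃), M (Mellin–Laplace transform), Q (Weil's quadratic functional, polar − prime + archimedean) —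
and DEFINITIONALLY EQUAL (Iff.rfl, Defeq.lean) to the rev-0 form over
Literature.NumberTheory.LFunctions.WeilExplicit (rev-0 item stmt-RiemannHypothesis-17362:
IsWeilTest, weilQuadratic); provers `show` the Literature form at will.] -/
@[route_item "route-RiemannHypothesis-OddSector", crux]
def OddNegativityOffLine : Prop :=
  let C : (ℝ → ℂ) → ℝ → ℂ := fun g => MeasureTheory.convolution g (fun t => (starRingEnd ℂ) (g (-t))) (ContinuousLinearMap.mul ℂ ℂ) MeasureTheory.MeasureSpace.volume; let M : (ℝ → ℂ) → ℂ → ℂ := fun F s => ∫ t : ℝ, F t * Complex.exp ((s - 1 / 2) * t); let Q : (ℝ → ℂ) → ℂ := fun g => M (C g) 0 + M (C g) 1 - (∑' n : ℕ, ((ArithmeticFunction.vonMangoldt n : ℝ) : ℂ) / (Real.sqrt n : ℂ) * (C g (Real.log n) + C g (-Real.log n))) + ((1 / (2 * Real.pi) : ℂ) * (∫ t : ℝ, M (C g) (1 / 2 + t * Complex.I) * ((Complex.digamma (1 / 4 + t / 2 * Complex.I)).re : ℂ)) - C g 0 * (Real.log Real.pi : ℂ)); ¬ RiemannHypothesis →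 ∃ η : ℝ, 0 < η ∧ ∃ A : ℝ, ∀ a : ℝ, A ≤ a → ∃ h : ℝ → ℂ, (ContDiff ℝ ((⊤ : ℕ∞) : WithTop ℕ∞) h ∧ HasCompactSupport h) ∧ tsupport h ⊆ Set.Icc (-a) a ∧ (∀ t, h (-t) = -h t) ∧ ∫ t, ‖h t‖ ^ 2 = (1 : ℝ) ∧ (Q h).re ≤ -η

-- earlier OddArchAnchor (stmt-RiemannHypothesis-17363, replaced 2026-08-17T02:10:15Z -> stmt-RiemannHypothesis-17781): retired by None — ∀ a : ℝ, 0 < a → ∃ u : ℝ → ℂ, (MeasureTheory.MemLp u 2 ∧ ∃ g : ℕ → ℝ → ℂ, (∀ n, Literature.NumberTheory.LFunctions.IsWeilTest (g n) ∧ tsupport (g n) ⊆ Set.Icc (-a) a ∧ (∀ t, g n (-t) = -g n t) ∧ ∫ t, ‖g n t‖ ^ 2 = (1 : ℝ)) ∧ (∀ h : ℝ → ℂ, Literature.NumberTheory.LF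
/-- item stmt-RiemannHypothesis-17781 · support · rank 9 · closed · proved by Summit.RiemannHypothesis.RiemannHypothesis.Theorems.oddArchAnchor_proof @ 34c0c5daeb20 (prover) · by planner
sources: archive:2001/summits/rh/routes/odd-sector-eigenfunction-sign, arXiv:2311.13079, doi:10.1016/j.jfa.2004.02.005
[support] THE PRIME-FREE ANCHOR (2001 wall W-ARCH-odd, proved twice internally for every a > 0; off
the deciding path — it is the first lemma of the homotopy Approach and the in-kind inhabitant of the
thesis): for the archimedean part Q₀(g) = Re W_∞(g ⋆ g̃) alone, every window a > 0 carries an odd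
bottom state (minimising among smooth odd window tests for Q₀) that is real and ≥ 0 a.e. on (0,a)
(2001 COR 1.3 adds ε_od < λ_2,ev, edge value c₊(φ₀) > 0 by a Rellich–Pohozaev identity, φ₀ ∈ C^∞
with φ₀′(0) > 0; cf. the 1-D logarithmic Laplacian, arXiv:2311.13079 §8). [difficulty: L] [Lean
form, rev 1 (route-repair cone, 2026-08-17): stated over Mathlib primitives only — binders C
(autocorrelation g ⋆ g̃), M (Mellin–Laplace transform), Q₀ (the archimedean term W_∞ of the tree's
weilFunctional alone) — and DEFINITIONALLY EQUAL (Iff.rfl, Defeq.lean) to the rev-0 form over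
Literature.NumberTheory.LFunctions.WeilExplicit (rev-0 item stmt-RiemannHypothesis-17363:
IsWeilTest, weilArchTerm ∘ weilConv/weilReflect); provers `show` the Literature form at will.] -/
@[route_item "route-RiemannHypothesis-OddSector"]
def OddArchAnchor : Prop :=
  let C : (ℝ → ℂ) → ℝ → ℂ := fun g => MeasureTheory.convolution g (fun t => (starRingEnd ℂ) (g (-t))) (ContinuousLinearMap.mul ℂ ℂ) MeasureTheory.MeasureSpace.volume; let M : (ℝ → ℂ) → ℂ → ℂ := fun F s => ∫ t : ℝ, F t * Complex.exp ((s - 1 / 2) * t); let Q₀ : (ℝ → ℂ) → ℂ := fun g => (1 / (2 * Real.pi) : ℂ) * (∫ t : ℝ, M (C g) (1 / 2 + t * Complex.I) * ((Complex.digamma (1 / 4 + t / 2 * Complex.I)).re : ℂ)) - C g 0 * (Real.log Real.pi : ℂ); ∀ a : ℝ, 0 < a → ∃ u : ℝ → ℂ, (MeasureTheory.MemLp u 2 ∧ ∃ g : ℕ → ℝ → ℂ, (∀ n, (ContDiff ℝ ((⊤ : ℕ∞) : WithTop ℕ∞) (g n) ∧ HasCompactSupport (g n)) ∧ tsupport (g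 n) ⊆ Set.Icc (-a) a ∧ (∀ t, g n (-t) = -g n t) ∧ ∫ t, ‖g n t‖ ^ 2 = (1 : ℝ)) ∧ (∀ h : ℝ → ℂ, (ContDiff ℝ ((⊤ : ℕ∞) : WithTop ℕ∞) h ∧ HasCompactSupport h) → tsupport h ⊆ Set.Icc (-a) a → (∀ t, h (-t) = -h t) → ∫ t, ‖h t‖ ^ 2 = (1 : ℝ) → ∀ δ : ℝ, 0 < δ → ∀ᶠ n in Filter.atTop, (Q₀ (g n)).re ≤ (Q₀ h).re + δ) ∧ Filter.Tendsto (fun n => ∫ t, ‖g n t - u t‖ ^ 2) Filter.atTop (nhds 0)) ∧ (∀ᵐ t : ℝ, t ∈ Set.Ioo 0 a → (u t).im = 0 ∧ 0 ≤ (u t).re)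

/-- item stmt-RiemannHypothesis-17364 · assembly · rank 1 · closed · proved by Summit.RiemannHypothesis.RiemannHypothesis.Theorems.oddSectorAssembly_proof @ a7dc01590c33 (prover) · by planner
sources: Yoshida1992HermitianForms, Bombieri2000Weil
[assembly] OddBartaFloor → OddOneSignedWindows → OddNegativityOffLine → RiemannHypothesis (by
contradiction, as above). -/
@[route_item "route-RiemannHypothesis-OddSector"]
def Assembly : Prop :=
  OddBartaFloor → OddOneSignedWindows → OddNegativityOffLine → Summit.RiemannHypothesis

/-! D-0027 §2.1 — DECIDING THEOREM (planner-authored via `route open/edit --closes-file`; by planner-rrepair-RiemannHypothesis-OddSector-fb39d924-0 2026-08-17T02:10:15Z):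
its hypotheses are this route's items and its conclusion the sub-problem Statement (glue_lint), and it elaborates with this file. -/

/-- DECIDING THEOREM (D-0027 §2.1) of route OddSector. By contradiction: if RH fails,
`OddNegativityOffLine` (Yoshida's odd criterion, contrapositive, window-uniform) gives `η > 0` and a
height `A` beyond which every window carries a normalised odd test of energy `≤ -η`; `OddBartaFloor`
gives the floor `-e(a)` with `e → 0` at windows carrying a one-signed odd bottom state, and
`OddOneSignedWindows` supplies such windows beyond any height — so `-e(a) ≤ Re Q(h) ≤ -η < -e(a)`.
Rev 1 (route-repair, cone): unchanged logic over the cone-free restatements; the two energy bounds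
are chained by `le_trans` (unification up to ζβδ of the `let`-inlined Weil vocabulary) and the only
arithmetic is on the reals `e a`, `η`. Axioms: propext, Classical.choice, Quot.sound. -/
@[closes "route-RiemannHypothesis-OddSector"] theorem closes (hBarta : OddBartaFloor) (hSign : OddOneSignedWindows)
    (hNeg : OddNegativityOffLine) : _root_.Summit.RiemannHypothesis := by
  show _root_.RiemannHypothesis
  by_contra hRH
  obtain ⟨η, hη, A, hAneg⟩ := hNeg hRH
  obtain ⟨e, he, a₀, hfloor⟩ := hBarta
  have hev : ∀ᶠ a in Filter.atTop, e a < η := he.eventually (Iio_mem_nhds hη)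
  obtain ⟨A₁, hA₁⟩ := Filter.eventually_atTop.1 hev
  obtain ⟨a, ha, u, hu, hsign⟩ := hSign (max (max A a₀) A₁)
  have haA : A ≤ a := le_trans (le_trans (le_max_left _ _) (le_max_left _ _)) ha
  have ha₀ : a₀ ≤ a := le_trans (le_trans (le_max_right _ _) (le_max_left _ _)) ha
  have haA₁ : A₁ ≤ a := le_trans (le_max_right _ _) ha
  obtain ⟨h, hh, hsupp, hodd, hnorm, hneg⟩ := hAneg a haA
  have h1 := hfloor a ha₀ ⟨u, hu, hsign⟩ h hh hsupp hodd hnorm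
  have h2 : e a < η := hA₁ a haA₁
  have h3 : -e a ≤ -η := le_trans h1 hneg
  linarith

end Summit.RiemannHypothesis.RiemannHypothesis.Theses.OddSector
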